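import Mathlib
import HarnessLib
import Literature.MathematicalPhysics.KineticTheory.LangevinChainGibbs
import Summits.AtomisticToContinuum.FouriersLaw.Theorems.JunctionLocalityInsertionCutoff
import Summits.AtomisticToContinuum.FouriersLaw.Theorems.JunctionLocalityInsertionIBP
import Literature.MathematicalPhysics.KineticTheory.VelocityFlipNoise

/-!
# Insertion identity toolbox, V: removing the cutoff; momentum-exchange symmetry; Cauchy–Schwarz

Support file for stub `stub_insertionIdentity` (line `thermalise-then-cut-probe-insertion`, crux
`stmt-AtomisticToContinuum-11748`). Dominated-convergence lemmas for the energy cutoffs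
(`∫ χ_n Φ → ∫ Φ`, `∫ (S_i χ_n) Φ → 0`, `∫ (∂_{p_i}χ_n) Φ → 0` and their weighted sums, for `Φ ∈ L¹`),
the cut-off thermostat image `χ_n S_c g = S_c(χ_n g) − g S_cχ_n − 2T ∑ c_i ∂_iχ_n ∂_i g`, the
invariance of every Gibbs state under the exchange of two momenta (so `∫ H p_a² = ∫ H p_b²`), and the
squared Cauchy–Schwarz inequality in `L²`. All [folklore]. No definitions.
-/

noncomputable section

open scoped ContDiff Topology ENNReal NNReal Convolution Pointwise
open MeasureTheory ProbabilityTheory Filter Set Function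
open Literature.MathematicalPhysics.KineticTheory.HeatConduction

namespace Summit.AtomisticToContinuum.FouriersLaw.Cruxes.SuperadditiveResistance.InsertionToolbox

local notation "uP" i' => ((0, Pi.single i' 1) : PhaseSpace _)
local notation "uQ" i' => ((Pi.single i' 1, 0) : PhaseSpace _)

local notation "OU⟦" T' ";" i' ";" f' ";" x' "⟧" =>
  T' * partialP i' (partialP i' f') x' - Prod.snd (x' : PhaseSpace _) i' * partialP i' f' x'
local notation "XH⟦" P' ";" f' ";" x' "⟧" =>
  ∑ i, (Prod.snd (x' : PhaseSpace _) i * partialQ i f' x' -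
    partialQ i (OscillatorChain.hamiltonian P' _) x' * partialP i f' x')
local notation "GEN⟦" P' ";" T' ";" c' ";" f' ";" x' "⟧" =>
  XH⟦P' ; f' ; x'⟧ + ∑ i, c' i * OU⟦T' ; i ; f' ; x'⟧
local notation "CUT⟦" ω₂' ";" lam' ";" β' ";" γ' ";" n' ";" x' "⟧" =>
  Real.smoothTransition (2 - OscillatorChain.hamiltonian (pinnedChain ω₂' lam' β' γ') _ x' / ((n' : ℝ) + 1))

variable {L : ℕ}

/-! ### Removing the cutoff: three dominated-convergence lemmas

For any finite measure `ν` on phase space and `Φ ∈ L¹(ν)`: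
`∫ χ_n Φ → ∫ Φ`, `∫ (S_i χ_n) Φ → 0`, `∫ (∂_{p_i} χ_n) Φ → 0`.
-/

section RemoveCutoff

variable {ω₂ lam β : ℝ}

set_option hygiene false in
local notation "χ⟦" n' "⟧" => fun y : PhaseSpace L => CUT⟦ω₂ ; lam ; β ; γ ; n' ; y⟧

/-- `∫ χ_n Φ dν → ∫ Φ dν` for `Φ ∈ L¹(ν)`. [folklore] -/
theorem tendsto_integral_cutoff_mul (γ : ℝ) (L : ℕ) (ν : Measure (PhaseSpace L))
    {Φ : PhaseSpace L → ℝ} (hΦ : Integrable Φ ν) :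
    Tendsto (fun n : ℕ => ∫ x, CUT⟦ω₂ ; lam ; β ; γ ; n ; x⟧ * Φ x ∂ν) atTop (𝓝 (∫ x, Φ x ∂ν)) := by
  refine tendsto_integral_of_dominated_convergence (fun x => |Φ x|) (fun n => ?_) hΦ.abs
    (fun n => ae_of_all _ fun x => ?_) (ae_of_all _ fun x => ?_)
  · exact ((contDiff_cutoff_nat ω₂ lam β γ L n 0).continuous.aestronglyMeasurable).mul hΦ.1
  · have h := cutoff_mem_Icc ω₂ lam β γ L n x
    rw [Real.norm_eq_abs, abs_mul, abs_of_nonneg h.1]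
    exact mul_le_of_le_one_left (abs_nonneg _) h.2
  · simpa using (tendsto_cutoff ω₂ lam β γ L x).mul_const (Φ x)

/-- `∫ (S_i χ_n) Φ dν → 0` for `Φ ∈ L¹(ν)` (the thermostat image of the cutoff is uniformly bounded
and eventually zero at every point). [folklore] -/
theorem tendsto_integral_ou_cutoff_mul (hω : 0 ≤ ω₂) (hl : 0 ≤ lam) (hβ : 0 ≤ β) (γ : ℝ) (L : ℕ)
    (T : ℝ) (ν : Measure (PhaseSpace L)) {Φ : PhaseSpace L → ℝ} (hΦ : Integrable Φ ν) (i : Fin L) :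
    Tendsto (fun n : ℕ => ∫ x, OU⟦T ; i ; χ⟦n⟧ ; x⟧ * Φ x ∂ν) atTop (𝓝 0) := by
  obtain ⟨C, hC0, hC⟩ := exists_cutoff_bounds hω hl hβ γ L T
  have h := tendsto_integral_of_dominated_convergence (μ := ν)
    (F := fun (n : ℕ) x => OU⟦T ; i ; χ⟦n⟧ ; x⟧ * Φ x) (f := fun _ => 0) (fun x => C * |Φ x|)
    (fun n => ?_) (hΦ.abs.const_mul C) (fun n => ae_of_all _ fun x => ?_) (ae_of_all _ fun x => ?_)
  · simpa using h
  · exact (continuous_ou T (contDiff_cutoff_nat ω₂ lam β γ L n 2) i).aestronglyMeasurable.mul hΦ.1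
  · rw [Real.norm_eq_abs, abs_mul]
    exact mul_le_mul_of_nonneg_right (hC n i x).2 (abs_nonneg _)
  · refine tendsto_const_nhds.congr' ?_
    filter_upwards [eventually_cutoff_derivs_eq_zero ω₂ lam β γ L T x] with n hn
    rw [(hn i).2, zero_mul]

/-- `∫ (∂_{p_i} χ_n) Φ dν → 0` for `Φ ∈ L¹(ν)`. [folklore] -/
theorem tendsto_integral_partialP_cutoff_mul (hω : 0 ≤ ω₂) (hl : 0 ≤ lam) (hβ : 0 ≤ β) (γ : ℝ)
    (L : ℕ) (ν : Measure (PhaseSpace L)) {Φ : PhaseSpace L → ℝ} (hΦ : Integrable Φ ν) (i : Fin L) :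
    Tendsto (fun n : ℕ => ∫ x, partialP i χ⟦n⟧ x * Φ x ∂ν) atTop (𝓝 0) := by
  obtain ⟨C, hC0, hC⟩ := exists_cutoff_bounds hω hl hβ γ L 0
  have h := tendsto_integral_of_dominated_convergence (μ := ν)
    (F := fun (n : ℕ) x => partialP i χ⟦n⟧ x * Φ x) (f := fun _ => 0) (fun x => C * |Φ x|)
    (fun n => ?_) (hΦ.abs.const_mul C) (fun n => ae_of_all _ fun x => ?_) (ae_of_all _ fun x => ?_)
  · simpa using h
  · exact (continuous_partialP (contDiff_cutoff_nat ω₂ lam β γ L n 1) one_ne_zero i).aestronglyMeasurable.mul hΦ.1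
  · rw [Real.norm_eq_abs, abs_mul]
    refine mul_le_mul_of_nonneg_right (((hC n i x).1).trans (div_le_self hC0 ?_)) (abs_nonneg _)
    rw [Real.le_sqrt (by norm_num) (by positivity)]; simp
  · refine tendsto_const_nhds.congr' ?_
    filter_upwards [eventually_cutoff_derivs_eq_zero ω₂ lam β γ L 0 x] with n hn
    rw [(hn i).1, zero_mul]

end RemoveCutoff

section Pairings

variable {ω₂ lam β : ℝ}

set_option hygiene false in
local notation "Pch" => pinnedChain ω₂ lam β γ
set_option hygiene false in
local notation "μ♭" => OscillatorChain.gibbsMeasure (pinnedChain ω₂ lam β γ) L T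
set_option hygiene false in
local notation "ρ♭" => OscillatorChain.gibbsDensity (pinnedChain ω₂ lam β γ) L T
set_option hygiene false in
local notation "χ⟦" n' "⟧" => fun y : PhaseSpace L => CUT⟦ω₂ ; lam ; β ; γ ; n' ; y⟧
local notation "SC⟦" T' ";" c' ";" f' ";" x' "⟧" => ∑ i, c' i * OU⟦T' ; i ; f' ; x'⟧

/-- Gibbs-measure form of an identity between `ρ`-weighted Lebesgue integrals. [folklore] -/
theorem integral_gibbsMeasure_congr (P : OscillatorChain) (L : ℕ) (T : ℝ) {f g : PhaseSpace L → ℝ}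
    (h : ∫ x, f x * P.gibbsDensity L T x = ∫ x, g x * P.gibbsDensity L T x) :
    ∫ x, f x ∂(P.gibbsMeasure L T) = ∫ x, g x ∂(P.gibbsMeasure L T) := by
  rw [P.integral_gibbsMeasure, P.integral_gibbsMeasure, h]

/-- The cut-off thermostat image: `χ_n S_c g = S_c(χ_n g) − g S_cχ_n − 2T ∑ c_i ∂_iχ_n ∂_i g`
(pointwise, `g ∈ C²`). [folklore] -/
theorem cutoff_mul_ouSum (γ : ℝ) (L : ℕ) (T : ℝ) (c : Fin L → ℝ) (n : ℕ) {g : PhaseSpace L → ℝ}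
    (hg : ContDiff ℝ 2 g) (x : PhaseSpace L) :
    CUT⟦ω₂ ; lam ; β ; γ ; n ; x⟧ * SC⟦T ; c ; g ; x⟧ =
      SC⟦T ; c ; fun y => CUT⟦ω₂ ; lam ; β ; γ ; n ; y⟧ * g y ; x⟧ -
        g x * SC⟦T ; c ; χ⟦n⟧ ; x⟧ -
        2 * T * ∑ i, c i * (partialP i χ⟦n⟧ x * partialP i g x) := by
  have hχ : ContDiff ℝ 2 χ⟦n⟧ := contDiff_cutoff_nat ω₂ lam β γ L n 2
  simp only [ou_mul hχ hg, Finset.mul_sum]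
  rw [← Finset.sum_sub_distrib, ← Finset.sum_sub_distrib]
  exact Finset.sum_congr rfl fun i _ => by ring

/-- Integrability of `c_i ∂_{p_i}χ_n · Φ` (zero when `c_i = 0`, bounded × `L¹` otherwise). [folklore] -/
theorem integrable_weight_partialP_cutoff_mul (hω : 0 < ω₂) (hl : 0 ≤ lam) (hβ : 0 ≤ β) (γ : ℝ)
    (L : ℕ) (T : ℝ) (c : Fin L → ℝ) (ν : Measure (PhaseSpace L)) (n : ℕ) (i : Fin L)
    {Φ : PhaseSpace L → ℝ} (hΦ : c i ≠ 0 → Integrable Φ ν) :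
    Integrable (fun x : PhaseSpace L => c i * (partialP i χ⟦n⟧ x * Φ x)) ν := by
  by_cases hi : c i = 0
  · simp only [hi, zero_mul]; exact integrable_zero _ _ _
  · obtain ⟨C, hC0, hC⟩ := exists_cutoff_bounds hω.le hl hβ γ L T
    have h := (hΦ hi).bdd_mul
      (continuous_partialP (contDiff_cutoff_nat ω₂ lam β γ L n 1) one_ne_zero i).aestronglyMeasurable
      (ae_of_all _ fun x => by
        rw [Real.norm_eq_abs]
        exact ((hC n i x).1).trans (div_le_self hC0 (by
          rw [Real.le_sqrt (by norm_num) (by positivity)]; simp)))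
    exact h.const_mul (c i)

/-- `∑ c_i ∫ ∂_{p_i}χ_n · Φ_i → 0` when `Φ_i ∈ L¹` for `c_i ≠ 0`. [folklore] -/
theorem tendsto_sum_weight_partialP_cutoff_mul (hω : 0 < ω₂) (hl : 0 ≤ lam) (hβ : 0 ≤ β) (γ : ℝ)
    (L : ℕ) (c : Fin L → ℝ) (ν : Measure (PhaseSpace L)) {Φ : Fin L → PhaseSpace L → ℝ}
    (hΦ : ∀ i, c i ≠ 0 → Integrable (Φ i) ν) :
    Tendsto (fun n : ℕ => ∑ i, c i * ∫ x, partialP i χ⟦n⟧ x * Φ i x ∂ν) atTop (𝓝 0) := by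
  have h : Tendsto (fun n : ℕ => ∑ i, c i * ∫ x, partialP i χ⟦n⟧ x * Φ i x ∂ν) atTop
      (𝓝 (∑ i : Fin L, c i * (0 : ℝ))) := by
    refine tendsto_finsetSum (Finset.univ : Finset (Fin L)) fun i _ => ?_
    by_cases hi : c i = 0
    · rw [show (fun n : ℕ => c i * ∫ x, partialP i χ⟦n⟧ x * Φ i x ∂ν) = fun _ => c i * 0 from
        funext fun n => by rw [hi, zero_mul, zero_mul]]
      exact tendsto_const_nhds
    · exact (tendsto_integral_partialP_cutoff_mul hω.le hl hβ γ L ν (hΦ i hi) i).const_mul (c i)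
  simpa using h

/-- Integrability of `(S_c χ_n) · Φ` for `Φ ∈ L¹` (the factor is bounded). [folklore] -/
theorem integrable_ouSum_cutoff_mul (hω : 0 < ω₂) (hl : 0 ≤ lam) (hβ : 0 ≤ β) (γ : ℝ) (L : ℕ)
    (T : ℝ) (c : Fin L → ℝ) (ν : Measure (PhaseSpace L)) (n : ℕ) {Φ : PhaseSpace L → ℝ}
    (hΦ : Integrable Φ ν) :
    Integrable (fun x : PhaseSpace L => SC⟦T ; c ; χ⟦n⟧ ; x⟧ * Φ x) ν := by
  obtain ⟨C, hC0, hC⟩ := exists_cutoff_bounds hω.le hl hβ γ L T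
  have hc' : Continuous fun x : PhaseSpace L => SC⟦T ; c ; χ⟦n⟧ ; x⟧ :=
    continuous_finsetSum _ fun i _ => continuous_const.mul
      (continuous_ou T (contDiff_cutoff_nat ω₂ lam β γ L n 2) i)
  refine hΦ.bdd_mul hc'.aestronglyMeasurable (c := ∑ i, |c i| * C) (ae_of_all _ fun x => ?_)
  rw [Real.norm_eq_abs]
  refine (Finset.abs_sum_le_sum_abs _ _).trans (Finset.sum_le_sum fun i _ => ?_)
  rw [abs_mul]
  exact mul_le_mul_of_nonneg_left (hC n i x).2 (abs_nonneg _)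

/-- `∫ (S_c χ_n) Φ → 0` for `Φ ∈ L¹`. [folklore] -/
theorem tendsto_integral_ouSum_cutoff_mul (hω : 0 < ω₂) (hl : 0 ≤ lam) (hβ : 0 ≤ β) (γ : ℝ)
    (L : ℕ) (T : ℝ) (c : Fin L → ℝ) (ν : Measure (PhaseSpace L)) {Φ : PhaseSpace L → ℝ}
    (hΦ : Integrable Φ ν) :
    Tendsto (fun n : ℕ => ∫ x, SC⟦T ; c ; χ⟦n⟧ ; x⟧ * Φ x ∂ν) atTop (𝓝 0) := by
  have e : ∀ n : ℕ, ∫ x, SC⟦T ; c ; χ⟦n⟧ ; x⟧ * Φ x ∂ν =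
      ∑ i, c i * ∫ x, OU⟦T ; i ; χ⟦n⟧ ; x⟧ * Φ x ∂ν := by
    intro n
    obtain ⟨C, hC0, hC⟩ := exists_cutoff_bounds hω.le hl hβ γ L T
    have hint : ∀ i, Integrable (fun x : PhaseSpace L => c i * (OU⟦T ; i ; χ⟦n⟧ ; x⟧ * Φ x)) ν := by
      intro i
      have h := hΦ.bdd_mul (continuous_ou T (contDiff_cutoff_nat ω₂ lam β γ L n 2) i).aestronglyMeasurable
        (ae_of_all _ fun x => by rw [Real.norm_eq_abs]; exact (hC n i x).2)
      exact h.const_mul (c i)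
    simp only [Finset.sum_mul]
    rw [integral_finsetSum _ fun i _ => (hint i).congr (ae_of_all _ fun x => by ring)]
    exact Finset.sum_congr rfl fun i _ => by
      rw [← integral_const_mul]; exact integral_congr_ae (ae_of_all _ fun x => by ring)
  simp only [e]
  have := tendsto_finsetSum (Finset.univ : Finset (Fin L)) fun i _ =>
    (tendsto_integral_ou_cutoff_mul hω.le hl hβ γ L T ν hΦ i).const_mul (c i)
  simpa using this

end Pairings

/-! ### Momentum exchange symmetry of the Gibbs state; Cauchy–Schwarz -/

section Symmetry

variable {L : ℕ}

/-- Exchanging two momenta, `(q, p) ↦ (q, p ∘ swap a b)`, as a measurable equivalence. [folklore] -/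
theorem measurePreserving_momentumSwap_volume (a b : Fin L) :
    MeasurePreserving (fun x : PhaseSpace L => ((x.1, fun i => x.2 (Equiv.swap a b i)) : PhaseSpace L))
      (volume : Measure (PhaseSpace L)) volume := by
  have h : (fun x : PhaseSpace L => ((x.1, fun i => x.2 (Equiv.swap a b i)) : PhaseSpace L)) =
      Prod.map id (MeasurableEquiv.piCongrLeft (fun _ : Fin L => ℝ) (Equiv.swap a b)) := by
    funext x
    refine Prod.ext rfl ?_
    funext i
    simp only [Prod.map_snd, MeasurableEquiv.coe_piCongrLeft, Equiv.piCongrLeft_apply_eq_cast,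
      cast_eq, Equiv.symm_swap]
  rw [h]
  exact (MeasurePreserving.id (volume : Measure (Fin L → ℝ))).prod
    (volume_measurePreserving_piCongrLeft (fun _ : Fin L => ℝ) (Equiv.swap a b))

/-- The energy is invariant under exchanging two momenta. [folklore] -/
theorem hamiltonian_momentumSwap (P : OscillatorChain) (a b : Fin L) (x : PhaseSpace L) :
    P.hamiltonian L ((x.1, fun i => x.2 (Equiv.swap a b i)) : PhaseSpace L) = P.hamiltonian L x := by
  rw [P.hamiltonian_eq_kinetic_add_potential, P.hamiltonian_eq_kinetic_add_potential]
  congr 1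
  exact Equiv.sum_comp (Equiv.swap a b) (fun i => x.2 i ^ 2 / 2)

/-- **Exchanging two momenta preserves every Gibbs state** `Z⁻¹ e^{-H/T} dq dp`. [folklore] -/
theorem measurePreserving_momentumSwap_gibbsMeasure (P : OscillatorChain) (L : ℕ) (T : ℝ)
    (a b : Fin L) :
    MeasurePreserving (fun x : PhaseSpace L => ((x.1, fun i => x.2 (Equiv.swap a b i)) : PhaseSpace L))
      (P.gibbsMeasure L T) (P.gibbsMeasure L T) := by
  set e : PhaseSpace L ≃ᵐ PhaseSpace L :=
    { toFun := fun x => ((x.1, fun i => x.2 (Equiv.swap a b i)) : PhaseSpace L)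
      invFun := fun x => ((x.1, fun i => x.2 (Equiv.swap a b i)) : PhaseSpace L)
      left_inv := fun x => by
        refine Prod.ext rfl (funext fun i => ?_)
        simp [Equiv.swap_apply_self]
      right_inv := fun x => by
        refine Prod.ext rfl (funext fun i => ?_)
        simp [Equiv.swap_apply_self]
      measurable_toFun := (measurePreserving_momentumSwap_volume a b).measurable
      measurable_invFun := (measurePreserving_momentumSwap_volume a b).measurable } with he
  have hcoe : (⇑e : PhaseSpace L → PhaseSpace L) =
      fun x => ((x.1, fun i => x.2 (Equiv.swap a b i)) : PhaseSpace L) := rfl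
  have h := measurePreserving_tilted_of_invariant (μ := (volume : Measure (PhaseSpace L))) e
    (by rw [hcoe]; exact measurePreserving_momentumSwap_volume a b)
    (g := fun x => -P.hamiltonian L x / T) (fun x => by
      show -P.hamiltonian L (e x) / T = -P.hamiltonian L x / T
      rw [hcoe, hamiltonian_momentumSwap])
  rw [hcoe] at h
  exact h

/-- `∫ F(q, p ∘ swap a b) dμ_T = ∫ F dμ_T`. [folklore] -/
theorem integral_comp_momentumSwap_gibbsMeasure (P : OscillatorChain) (L : ℕ) (T : ℝ) (a b : Fin L)
    (F : PhaseSpace L → ℝ) :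
    ∫ x, F ((x.1, fun i => x.2 (Equiv.swap a b i)) : PhaseSpace L) ∂(P.gibbsMeasure L T) =
      ∫ x, F x ∂(P.gibbsMeasure L T) := by
  have h := measurePreserving_momentumSwap_gibbsMeasure P L T a b
  have hemb : MeasurableEmbedding
      (fun x : PhaseSpace L => ((x.1, fun i => x.2 (Equiv.swap a b i)) : PhaseSpace L)) := by
    refine (MeasurableEquiv.measurableEmbedding
      { toFun := fun x => ((x.1, fun i => x.2 (Equiv.swap a b i)) : PhaseSpace L)
        invFun := fun x => ((x.1, fun i => x.2 (Equiv.swap a b i)) : PhaseSpace L)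
        left_inv := fun x => by
          refine Prod.ext rfl (funext fun i => ?_)
          simp [Equiv.swap_apply_self]
        right_inv := fun x => by
          refine Prod.ext rfl (funext fun i => ?_)
          simp [Equiv.swap_apply_self]
        measurable_toFun := h.measurable
        measurable_invFun := h.measurable })
  exact h.integral_comp hemb F

/-- `∫ H p_a² dμ_T = ∫ H p_b² dμ_T` (exchange `p_a ↔ p_b`). [folklore] -/
theorem integral_hamiltonian_mul_sq_eq (P : OscillatorChain) (L : ℕ) (T : ℝ) (a b : Fin L) :
    ∫ x, P.hamiltonian L x * x.2 a ^ 2 ∂(P.gibbsMeasure L T) =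
      ∫ x, P.hamiltonian L x * x.2 b ^ 2 ∂(P.gibbsMeasure L T) := by
  rw [← integral_comp_momentumSwap_gibbsMeasure P L T a b (fun x => P.hamiltonian L x * x.2 a ^ 2)]
  refine integral_congr_ae (ae_of_all _ fun x => ?_)
  simp only [hamiltonian_momentumSwap, Equiv.swap_apply_left]

/-- **Cauchy–Schwarz in `L²(ν)`** in squared form: `(∫ u v)² ≤ (∫ u²)(∫ v²)` for `u, v ∈ L²(ν)`
(discriminant of `t ↦ ∫ (u − t v)² ≥ 0`). [folklore] -/
theorem sq_integral_mul_le {α : Type*} [MeasurableSpace α] {ν : Measure α} {u v : α → ℝ}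
    (hu : MemLp u 2 ν) (hv : MemLp v 2 ν) :
    (∫ x, u x * v x ∂ν) ^ 2 ≤ (∫ x, u x ^ 2 ∂ν) * ∫ x, v x ^ 2 ∂ν := by
  have huv : Integrable (fun x => u x * v x) ν := hu.integrable_mul hv
  have hu2 : Integrable (fun x => u x ^ 2) ν := hu.integrable_sq
  have hv2 : Integrable (fun x => v x ^ 2) ν := hv.integrable_sq
  -- `0 ≤ ∫ (u - t v)² = ∫u² - 2t ∫uv + t² ∫v²` for all `t`
  have key : ∀ t : ℝ, 0 ≤ (∫ x, v x ^ 2 ∂ν) * (t * t) + (-2 * ∫ x, u x * v x ∂ν) * t + ∫ x, u x ^ 2 ∂ν := by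
    intro t
    have h0 : 0 ≤ ∫ x, (u x - t * v x) ^ 2 ∂ν := integral_nonneg fun x => sq_nonneg _
    have e : ∫ x, (u x - t * v x) ^ 2 ∂ν =
        (∫ x, u x ^ 2 ∂ν) - 2 * t * (∫ x, u x * v x ∂ν) + t ^ 2 * ∫ x, v x ^ 2 ∂ν := by
      have h1 : Integrable (fun x => u x ^ 2 - 2 * t * (u x * v x)) ν := hu2.sub (huv.const_mul _)
      have h2 : Integrable (fun x => t ^ 2 * v x ^ 2) ν := hv2.const_mul _
      rw [← integral_const_mul, ← integral_const_mul, ← integral_sub hu2 (huv.const_mul _),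
        ← integral_add h1 h2]
      exact integral_congr_ae (ae_of_all _ fun x => by ring)
    rw [e] at h0
    nlinarith [h0]
  have hdisc := discrim_le_zero key
  rw [discrim] at hdisc
  nlinarith [hdisc]

end Symmetry

/-- Registered helper stub of this support file: Cauchy–Schwarz in squared form. [folklore] -/
theorem helper_insertionRemoveCutoff : ∀ {α : Type*} [MeasurableSpace α] {ν : Measure α} {u v : α → ℝ}, MemLp u 2 ν → MemLp v 2 ν → (∫ x, u x * v x ∂ν) ^ 2 ≤ (∫ x, u x ^ 2 ∂ν) * ∫ x, v x ^ 2 ∂ν := by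
  intro α _ ν u v hu hv
  exact sq_integral_mul_le hu hv

end Summit.AtomisticToContinuum.FouriersLaw.Cruxes.SuperadditiveResistance.InsertionToolbox

end
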